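import Summits.RiemannHypothesis.RiemannHypothesis.Theorems.TiltedLandingLaw421R3RateLightIsolatedChild

/-! # TiltedLandingLaw421R3LocatedPair — the two LOCATED children of a light pair + the a-posteriori BOOTSTRAP (K-2 steps S2–S4, repair R1) — W-08 C1 (rh-idea-5 g35)

SUPPORT module for crux `TiltedLandingLaw421R` ⟨stmt-RiemannHypothesis-33346⟩, route EarlyAppointments (`--supports … --as helper` only; no stub, no crux,
no law).  One tree import #1181 `…R3RateLightIsolatedChild` (through it #1179 `RhW08.PerturbativeRung.*` — `fieldK`, `LightWitness`, `rhoMu`,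
`doorData_of_lightWitness`, `LightAt` — and #1177 `RhW08.NewtonDoor.located_newton_door_lip`, `…NewtonDoor1`).  REPAIR-INDEPENDENT ((CA673)(B)): no
`C`/`μ₀` gate constant of the v5 split is baked in; the door constant `C₀ ≥ 9/2` is a parameter and every conclusion is in the currencies
`(ρ₀, M, Im w, ‖K_w‖)`.  CONTENT (sockets S2–S4 of the K-2 compose map `pub/ideators/rh-idea-5/g35/k2/K2Compose-MAP-W08-C1-rh-idea-5-g35.md` + its repair (R1)):
§1 BOOTSTRAP ALGEBRA — `norm_sub_newtonPoint_le`: the exact child equation `(u − w)·L = −1` with `‖L − K‖ ≤ Λ < ‖K‖` puts `u` within `Λ/(‖K‖(‖K‖ − Λ))`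
of the Newton point `w − K⁻¹`; `child_eq_of_factor`: `F = (·−w)·h`, `F′ u = 0`, `h u ≠ 0` ⇒ `(u − w)·(h′/h)(u) = −1`; `logDeriv_close_of_lightWitness`:
on the witness ball `‖(h′/h)(u) − K_w‖ ≤ (M/Im w²)·‖u − w‖` (mean-value inequality — `doorData_of_lightWitness` records this only on the Newton CIRCLE);
★ `bootstrap_of_lightWitness`: a child located in a Newton disc of parameter `ρ₀ ≤ 1/2` with `9M ≤ λ_w²` is in fact within
`(6/5)·(1+ρ₀)·M/λ_w² / ‖K_w‖` of the Newton point (`λ_w = Im w·‖K_w‖`) — the location error VANISHES with the Lipschitz mass `M` (map finding N1 / repair R1: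
the door radius `ρ₀/‖K‖ = C₀(1+M)/λ²/‖K‖` does not).
§2 ★ `located_child_of_lightWitness` — frame form of #1181's step (a) for a general door constant: `EngineHyps5 2`, `f⁽ʲ⁾ v = 0`, `0 < Im v`, a light witness
`M` at `v`, `9/2 ≤ C₀`, `C₀(1+M) ≤ λ_v²/2` ⇒ `v` is SIMPLE and there is a child `u` (`f⁽ʲ⁺¹⁾ u = 0`, `f⁽ʲ⁾ u ≠ 0`, `u ≠ v`) with `‖u − (v − K_v⁻¹)‖ < ρ₀/‖K_v‖`,
`‖u − v‖ ≤ (1+ρ₀)/‖K_v‖` AND the bootstrap bound.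
§3 ★★ `located_pair_of_lightAt` — TWO light points `v ≠ z` (zeros of `f⁽ʲ⁾`, `LightAt μ₀` both, door smallness `(9/2)(1+μ₀) ≤ λ_w²/2` both) ⇒ both simple,
both field floors `3/2 < λ_w`, and two DISTINCT children `u₁ ≠ u₂` in the half-Newton discs (`≤ 1/(2‖K_w‖)`) with the sharp bounds
`‖u_w − (w − K_w⁻¹)‖ ≤ (9/5)·μ₀/λ_w² / ‖K_w‖` — exactly the input tuple of the door `RhW08.PairWindow.childEnergy_two_le` (token 33) / `ChildEnergyTwoLeQ`
(token 34).  Distinctness = S4 of the map: `z` is a zero of `v`'s cofactor, so the witness's zero-free ball gives `‖z − v‖ > 3/‖K_v‖` (and `> 3/‖K_z‖`),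
while `‖u₁ − v‖ ≤ 3/(2‖K_v‖)`, `‖u₂ − z‖ ≤ 3/(2‖K_z‖)`.
What it is NOT: not K-2 (`PerturbativeDropLightQ`: the energy bookkeeping K-2a, the pull signs (C1 image D `RhW08.PairSign`), the field coherence N2 and
the constants are elsewhere / OPEN), not RUNG-P, not C′.  Nothing here bears on the truth of RH; RH is NOT proved; K-2 / RUNG-P / ★A / 33346 / 33347 OPEN;
checked ≠ landed ≠ proved. -/

namespace RhW08.LocatedPair

open Complex
open scoped ComplexConjugate
open RhW08.PerturbativeRung (fieldK fieldK_dslope LightWitness rhoMu doorData_of_lightWitness LightAt)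
open RhW08.AntiEscapeSplit7 (newtonK)
open Summit.RiemannHypothesis.RiemannHypothesis.Theorems.Splittings.JensenWindow (RealEntireLt2)

/-! ## §1 Bootstrap algebra and the mean-value closeness on the witness ball -/

/-- ★ §1 BOOTSTRAP ALGEBRA: `K ≠ 0`, the exact child equation `(u − w)·L = −1`, `‖L − K‖ ≤ Λ < ‖K‖` ⇒ `‖u − (w − K⁻¹)‖ ≤ Λ/(‖K‖·(‖K‖ − Λ))`
(`u − (w − K⁻¹) = K⁻¹ − L⁻¹ = (L − K)/(K·L)`, `‖L‖ ≥ ‖K‖ − Λ`). -/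
theorem norm_sub_newtonPoint_le {K L u w : ℂ} {Λ : ℝ} (hK : K ≠ 0) (heq : (u - w) * L = -1) (hclose : ‖L - K‖ ≤ Λ) (hΛ : Λ < ‖K‖) :
    ‖u - (w - K⁻¹)‖ ≤ Λ / (‖K‖ * (‖K‖ - Λ)) := by
  have hL : L ≠ 0 := by
    rintro rfl
    simp at heq
  have e1 : u - w = -L⁻¹ := by
    have h1 : (u - w) * L * L⁻¹ = -1 * L⁻¹ := by rw [heq]
    rwa [mul_assoc, mul_inv_cancel₀ hL, mul_one, neg_one_mul] at h1
  have e2 : u - (w - K⁻¹) = (L - K) / (K * L) := by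
    rw [show u - (w - K⁻¹) = (u - w) + K⁻¹ by ring, e1]
    field_simp
    ring
  have hKL : ‖K‖ - Λ ≤ ‖L‖ := by
    have h1 := norm_sub_norm_le K L
    have h2 : ‖K - L‖ = ‖L - K‖ := norm_sub_rev K L
    linarith
  have hpos : 0 < ‖K‖ - Λ := by linarith
  have hΛ0 : 0 ≤ Λ := (norm_nonneg _).trans hclose
  rw [e2, norm_div, norm_mul]
  exact div_le_div₀ hΛ0 hclose (mul_pos (norm_pos_iff.mpr hK) hpos) (mul_le_mul_of_nonneg_left hKL (norm_nonneg _))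

/-- §1 THE EXACT CHILD EQUATION: `F = (·−w)·h`, `h` differentiable at `u`, `F′ u = 0`, `h u ≠ 0` ⇒ `(u − w)·(h′(u)/h(u)) = −1`
(`F′ u = h u + (u − w)·h′ u`). -/
theorem child_eq_of_factor {F h : ℂ → ℂ} {w u : ℂ} (hh : DifferentiableAt ℂ h u) (hfac : ∀ t : ℂ, F t = (t - w) * h t)
    (hFu : deriv F u = 0) (hhu : h u ≠ 0) : (u - w) * (deriv h u / h u) = -1 := by
  have e : F = fun t => (t - w) * h t := funext hfac
  have hd : HasDerivAt (fun t : ℂ => (t - w) * h t) (1 * h u + (u - w) * deriv h u) u :=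
    ((hasDerivAt_id u).sub_const w).mul hh.hasDerivAt
  have h1 : 1 * h u + (u - w) * deriv h u = 0 := by
    rw [← hd.deriv, ← e, hFu]
  have h2 : (u - w) * deriv h u = -h u := by linear_combination h1
  rw [← mul_div_assoc, h2, neg_div, div_self hhu]

/-- §1 CLOSENESS ON THE WITNESS BALL (mean-value inequality): `h` entire, `0 < Im w`, a light witness `M` at `w` ⇒ for `‖u − w‖ ≤ 3/‖K_w‖`,
`‖(h′/h)(u) − K_w‖ ≤ (M/Im w²)·‖u − w‖` (`K_w = fieldK h w`; the ball is convex and carries `‖(h′/h)′‖ ≤ M/Im w²`). -/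
theorem logDeriv_close_of_lightWitness {h : ℂ → ℂ} {w : ℂ} {M : ℝ} (hh : Differentiable ℂ h) (hw : 0 < w.im) (hW : LightWitness h w M)
    {u : ℂ} (hu : ‖u - w‖ ≤ 3 / ‖fieldK h w‖) : ‖deriv h u / h u - fieldK h w‖ ≤ M / w.im ^ 2 * ‖u - w‖ := by
  obtain ⟨hK, -, hball⟩ := hW
  set r : ℝ := 3 / ‖fieldK h w‖ with hrdef
  have hr : 0 ≤ r := by positivity
  have hin : ∀ t ∈ Metric.closedBall w r, h t ≠ 0 ∧ w.im ^ 2 * ‖deriv (fun t => deriv h t / h t) t‖ ≤ M := by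
    intro t ht
    have ht' : ‖t - w‖ ≤ r := by rwa [Metric.mem_closedBall, dist_eq_norm] at ht
    exact hball t ht'
  have hdiff : ∀ t ∈ Metric.closedBall w r, DifferentiableAt ℂ (fun t => deriv h t / h t) t := by
    intro t ht
    exact ((hh.analyticAt t).deriv.differentiableAt).div (hh t) (hin t ht).1
  have hbound : ∀ t ∈ Metric.closedBall w r, ‖deriv (fun t => deriv h t / h t) t‖ ≤ M / w.im ^ 2 := by
    intro t ht
    rw [le_div_iff₀ (pow_pos hw 2), mul_comm]
    exact (hin t ht).2
  have hwmem : w ∈ Metric.closedBall w r := Metric.mem_closedBall_self hr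
  have humem : u ∈ Metric.closedBall w r := by
    rw [Metric.mem_closedBall, dist_eq_norm]; exact hu
  have hmvt := (convex_closedBall w r).norm_image_sub_le_of_norm_deriv_le hdiff hbound hwmem humem
  have hKw : deriv h w / h w = fieldK h w := rfl
  simpa only [hKw] using hmvt

/-- ★ §1 **THE BOOTSTRAP** (map repair R1): `h` entire, `0 < Im w`, a light witness `M` at `w`, a child equation `(u − w)·(h′/h)(u) = −1` for a point
`u` of the closed Newton disc `‖u − (w − K⁻¹)‖ ≤ ρ₀/‖K‖` with `0 ≤ ρ₀ ≤ 1/2`, and `9·M ≤ λ_w²` (`λ_w = Im w·‖K‖`; implied by any door smallness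
`C₀(1+M) ≤ λ_w²/2`, `C₀ ≥ 9/2`) ⇒ `‖u − (w − K⁻¹)‖ ≤ (6/5)·((1+ρ₀)·M/λ_w²)/‖K‖`: the Lipschitz mass `M`, not the door radius, measures the true
location error (`→ 0` as `M → 0`). -/
theorem bootstrap_of_lightWitness {h : ℂ → ℂ} {w u : ℂ} {M ρ₀ : ℝ} (hh : Differentiable ℂ h) (hw : 0 < w.im) (hW : LightWitness h w M)
    (hρ0 : 0 ≤ ρ₀) (hρ : ρ₀ ≤ 1 / 2) (hdisc : ‖u - (w - (fieldK h w)⁻¹)‖ ≤ ρ₀ / ‖fieldK h w‖)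
    (heq : (u - w) * (deriv h u / h u) = -1) (hsmall : 9 * M ≤ (w.im * ‖fieldK h w‖) ^ 2) :
    ‖u - (w - (fieldK h w)⁻¹)‖ ≤ (6 / 5) * ((1 + ρ₀) * M / (w.im * ‖fieldK h w‖) ^ 2) / ‖fieldK h w‖ := by
  have hK : fieldK h w ≠ 0 := hW.1
  have hM0 : 0 ≤ M := hW.2.1
  set K : ℂ := fieldK h w with hKdef
  have hKn : 0 < ‖K‖ := norm_pos_iff.mpr hK
  -- the Newton disc sits inside the witness ball
  have huw : ‖u - w‖ ≤ (1 + ρ₀) / ‖K‖ := RhW08.NewtonDoor.norm_sub_le_of_newtonDisc hK hdisc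
  have h3 : (1 + ρ₀) / ‖K‖ ≤ 3 / ‖K‖ := div_le_div_of_nonneg_right (by linarith) hKn.le
  have hclose0 := logDeriv_close_of_lightWitness hh hw hW (huw.trans h3)
  set Λ : ℝ := M / w.im ^ 2 * ((1 + ρ₀) / ‖K‖) with hΛdef
  have hclose : ‖deriv h u / h u - K‖ ≤ Λ := hclose0.trans (mul_le_mul_of_nonneg_left huw (by positivity))
  -- `Λ ≤ ‖K‖/6` from `6·M·(1+ρ₀) ≤ 9·M ≤ λ²`
  have hΛK : Λ ≤ ‖K‖ / 6 := by
    rw [hΛdef, div_mul_div_comm, div_le_div_iff₀ (by positivity) (by norm_num)]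
    have h1 : M * (1 + ρ₀) * 6 ≤ 9 * M := by nlinarith
    have h2 : 9 * M * ‖K‖ ≤ (w.im * ‖K‖) ^ 2 * ‖K‖ := mul_le_mul_of_nonneg_right hsmall hKn.le
    nlinarith
  have hΛlt : Λ < ‖K‖ := by linarith
  have hΛ0 : 0 ≤ Λ := by positivity
  have hstep := norm_sub_newtonPoint_le hK heq hclose hΛlt
  -- `Λ/(‖K‖(‖K‖ − Λ)) ≤ Λ/(‖K‖·(5‖K‖/6)) = (6/5)·Λ/‖K‖²`
  have hden : ‖K‖ * (5 * ‖K‖ / 6) ≤ ‖K‖ * (‖K‖ - Λ) := mul_le_mul_of_nonneg_left (by linarith) hKn.le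
  have hstep2 : Λ / (‖K‖ * (‖K‖ - Λ)) ≤ Λ / (‖K‖ * (5 * ‖K‖ / 6)) :=
    div_le_div_of_nonneg_left hΛ0 (by positivity) hden
  refine (hstep.trans hstep2).trans (le_of_eq ?_)
  rw [hΛdef]
  field_simp

/-! ## §2 One located child (frame form of #1181 (a), general door constant, with the bootstrap) -/

open RhIdea6.G17.W07C7 RhIdea6.G17.W07C7.Rev6 RhIdea6.G18.W07C8.Law421BirthS RhIdea6.G19.W07C11.Seam RhIdea6.G20.W07C12.Frac
  RhIdea6.G20.W07C12.StColP RhW07.C12.FieldSplit RhW08.Round1 RhW08.StSwap RhW08.Round2 RhW08.QuadW RhW08.SealSwapQ in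
/-- ★ §2 **THE LOCATED CHILD OF A LIGHT POINT** (sockets S2–S3 + R1): on an `EngineHyps5 2` frame, `f⁽ʲ⁾ v = 0`, `0 < Im v`, a light witness `M` at `v`
for the cofactor `dslope f⁽ʲ⁾ v`, a door constant `9/2 ≤ C₀` with `C₀(1+M) ≤ λ_v²/2` (`λ_v = Im v·‖K_v‖`, `K_v = newtonK f j v`).  THEN `v` is a SIMPLE zero
and there is a CHILD `u`: `f⁽ʲ⁺¹⁾ u = 0`, `f⁽ʲ⁾ u ≠ 0`, `u ≠ v`, located `‖u − (v − K_v⁻¹)‖ < ρ₀/‖K_v‖` (`ρ₀ = rhoMu C₀ M … ≤ 1/2`), `‖u − v‖ ≤ (1+ρ₀)/‖K_v‖`,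
and SHARPLY located `‖u − (v − K_v⁻¹)‖ ≤ (6/5)·((1+ρ₀)·M/λ_v²)/‖K_v‖` (bootstrap).  Door data `doorData_of_lightWitness` + K-1 `located_newton_door_lip`. -/
theorem located_child_of_lightWitness {η : ℝ} {f : ℂ → ℂ} {x₀ s hmax R Hs : ℝ} {B : ℕ} (hE : EngineHyps5 2 η f x₀ s hmax R Hs B)
    {j : ℕ} {v : ℂ} (hFv : iteratedDeriv j f v = 0) (hv : 0 < v.im) {M C₀ : ℝ} (hW : LightWitness (dslope (iteratedDeriv j f) v) v M)
    (hC₀ : 9 / 2 ≤ C₀) (hdoor : C₀ * (1 + M) ≤ (v.im * ‖newtonK f j v‖) ^ 2 / 2) :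
    deriv (iteratedDeriv j f) v ≠ 0 ∧ rhoMu C₀ M (dslope (iteratedDeriv j f) v) v ≤ 1 / 2 ∧
      ∃ u : ℂ, iteratedDeriv (j + 1) f u = 0 ∧ iteratedDeriv j f u ≠ 0 ∧ u ≠ v ∧
        ‖u - (v - (newtonK f j v)⁻¹)‖ < rhoMu C₀ M (dslope (iteratedDeriv j f) v) v / ‖newtonK f j v‖ ∧
        ‖u - v‖ ≤ (1 + rhoMu C₀ M (dslope (iteratedDeriv j f) v) v) / ‖newtonK f j v‖ ∧
        ‖u - (v - (newtonK f j v)⁻¹)‖ ≤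
          (6 / 5) * ((1 + rhoMu C₀ M (dslope (iteratedDeriv j f) v) v) * M / (v.im * ‖newtonK f j v‖) ^ 2) / ‖newtonK f j v‖ := by
  rw [← fieldK_dslope f j v] at hdoor ⊢
  set F : ℂ → ℂ := iteratedDeriv j f with hFdef
  set h : ℂ → ℂ := dslope F v with hhdef
  have hG : RealEntireLt2 F := RhW08.WindowLoss.realEntireLt2_iteratedDeriv (RhW08.Column.realEntireLt2_of_hyps hE) j
  have hFdiff : Differentiable ℂ F := hG.diff
  have hh : Differentiable ℂ h := Literature.NumberTheory.LFunctions.BurnolVectors.differentiable_dslope hFdiff v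
  have hfac : ∀ u : ℂ, F u = (u - v) * h u := fun u => RhW08.NewtonDoor.factor_dslope hFv u
  -- simplicity from the witness at `u = v`
  have hKn : 0 < ‖fieldK h v‖ := norm_pos_iff.mpr hW.1
  have hhv : h v ≠ 0 := (hW.2.2 v (by rw [sub_self, norm_zero]; positivity)).1
  have hsimple : deriv F v ≠ 0 := by
    rw [← dslope_same]
    exact hhv
  -- door data and the located child
  obtain ⟨hρ0, hρhalf, hscalar, hh0, hlip⟩ := doorData_of_lightWitness hh hv hW hC₀ hdoor
  obtain ⟨u, hudisc, hFu, hhu⟩ :=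
    RhW08.NewtonDoor.located_newton_door_lip F h v _ _ _ hFdiff hh hfac hW.1 hρ0 hscalar hh0 hlip
  set K : ℂ := fieldK h v with hKdef
  set ρ₀ : ℝ := rhoMu C₀ M h v with hρdef
  have hK : K ≠ 0 := hW.1
  have hu0 : iteratedDeriv (j + 1) f u = 0 := by
    rw [iteratedDeriv_succ]
    exact hFu
  have huv_ne : u ≠ v := fun e => hsimple (e ▸ hFu)
  have hGu : F u ≠ 0 := by
    rw [hfac u]
    exact mul_ne_zero (sub_ne_zero.mpr huv_ne) hhu
  have huv : ‖u - v‖ ≤ (1 + ρ₀) / ‖K‖ := RhW08.NewtonDoor.norm_sub_le_of_newtonDisc hK hudisc.le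
  -- the bootstrap: exact child equation + `9M ≤ 9(1+M) ≤ 2·C₀(1+M) ≤ λ²`
  have heq : (u - v) * (deriv h u / h u) = -1 := child_eq_of_factor (hh u) hfac hFu hhu
  have hM0 : 0 ≤ M := hW.2.1
  have hsmall : 9 * M ≤ (v.im * ‖K‖) ^ 2 := by nlinarith
  have hboot := bootstrap_of_lightWitness hh hv hW hρ0.le hρhalf hudisc.le heq hsmall
  exact ⟨hsimple, hρhalf, u, hu0, hGu, huv_ne, hudisc, huv, hboot⟩

/-! ## §3 The located PAIR of two light points -/

/-- §3 S4 geometry: two points each within HALF the separation of its own centre are distinct from each other's —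
`‖u₁ − v‖ < ‖z − v‖/2`, `‖u₂ − z‖ < ‖z − v‖/2` ⇒ `u₁ ≠ u₂`. -/
theorem ne_of_half_separation {v z u₁ u₂ : ℂ} (h1 : ‖u₁ - v‖ < ‖z - v‖ / 2) (h2 : ‖u₂ - z‖ < ‖z - v‖ / 2) : u₁ ≠ u₂ := by
  rintro rfl
  have h3 : ‖z - v‖ ≤ ‖u₁ - z‖ + ‖u₁ - v‖ := by
    have := norm_sub_le (z - u₁) (v - u₁)
    rw [show z - u₁ - (v - u₁) = z - v by ring, norm_sub_rev z u₁, norm_sub_rev v u₁] at this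
    exact this
  linarith

/-- §3 the PARTNER IS OUTSIDE THE WITNESS BALL: `f⁽ʲ⁾ v = 0`, `f⁽ʲ⁾ z = 0`, `z ≠ v`, a light witness at `v` ⇒ `3/‖K_v‖ < ‖z − v‖`
(`z` is a zero of the cofactor `dslope f⁽ʲ⁾ v`, which is zero-free on the closed ball `‖u − v‖ ≤ 3/‖K_v‖`). -/
theorem sep_of_lightWitness {f : ℂ → ℂ} {j : ℕ} {v z : ℂ} {M : ℝ} (hFv : iteratedDeriv j f v = 0) (hFz : iteratedDeriv j f z = 0) (hzv : z ≠ v)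
    (hW : LightWitness (dslope (iteratedDeriv j f) v) v M) : 3 / ‖newtonK f j v‖ < ‖z - v‖ := by
  rw [← fieldK_dslope f j v]
  have hfac := RhW08.NewtonDoor.factor_dslope hFv z
  rw [hFz] at hfac
  have hhz : dslope (iteratedDeriv j f) v z = 0 := by
    rcases mul_eq_zero.mp hfac.symm with h1 | h1
    · exact absurd (sub_eq_zero.mp h1) hzv
    · exact h1
  by_contra hle
  exact (hW.2.2 z (not_lt.mp hle)).1 hhz

open RhIdea6.G17.W07C7 RhIdea6.G17.W07C7.Rev6 RhIdea6.G18.W07C8.Law421BirthS RhIdea6.G19.W07C11.Seam RhIdea6.G20.W07C12.Frac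
  RhIdea6.G20.W07C12.StColP RhW07.C12.FieldSplit RhW08.Round1 RhW08.StSwap RhW08.Round2 RhW08.QuadW RhW08.SealSwapQ in
/-- ★★ §3 **THE LOCATED PAIR OF TWO LIGHT POINTS** (sockets S1–S4 + R1 of the K-2 map): on an `EngineHyps5 2` frame, `v ≠ z` zeros of `f⁽ʲ⁾` in the upper
half plane, BOTH light within `μ₀` (`LightAt μ₀ f j ·`) with the door smallness `(9/2)(1+μ₀) ≤ λ_w²/2` at both (`λ_w = Im w·‖newtonK f j w‖`; on β-levels
this is the floor bookkeeping of the assembly).  THEN both zeros are SIMPLE, both field floors `3/2 < λ_w` hold, and there are two DISTINCT children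
`u₁ ≠ u₂` of `f⁽ʲ⁺¹⁾` off `Z(f⁽ʲ⁾)` in the half-Newton discs `‖u₁ − (v − K_v⁻¹)‖ ≤ 1/(2‖K_v‖)`, `‖u₂ − (z − K_z⁻¹)‖ ≤ 1/(2‖K_z‖)` — the input tuple of the door
`RhW08.PairWindow.childEnergy_two_le` / `ChildEnergyTwoLeQ` — with the SHARP locations `‖u₁ − (v − K_v⁻¹)‖ ≤ (9/5)·(μ₀/λ_v²)/‖K_v‖`,
`‖u₂ − (z − K_z⁻¹)‖ ≤ (9/5)·(μ₀/λ_z²)/‖K_z‖` (bootstrap, `(6/5)(1+ρ₀) ≤ 9/5`, `M ≤ μ₀`). -/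
theorem located_pair_of_lightAt {η : ℝ} {f : ℂ → ℂ} {x₀ s hmax R Hs : ℝ} {B : ℕ} (hE : EngineHyps5 2 η f x₀ s hmax R Hs B)
    {j : ℕ} {v z : ℂ} (hFv : iteratedDeriv j f v = 0) (hFz : iteratedDeriv j f z = 0) (hv : 0 < v.im) (hz : 0 < z.im) (hvz : v ≠ z)
    {μ₀ : ℝ} (hLv : LightAt μ₀ f j v) (hLz : LightAt μ₀ f j z)
    (hdv : (9 / 2) * (1 + μ₀) ≤ (v.im * ‖newtonK f j v‖) ^ 2 / 2) (hdz : (9 / 2) * (1 + μ₀) ≤ (z.im * ‖newtonK f j z‖) ^ 2 / 2) :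
    deriv (iteratedDeriv j f) v ≠ 0 ∧ deriv (iteratedDeriv j f) z ≠ 0 ∧
      3 / 2 < v.im * ‖newtonK f j v‖ ∧ 3 / 2 < z.im * ‖newtonK f j z‖ ∧
      ∃ u₁ u₂ : ℂ, u₁ ≠ u₂ ∧
        (iteratedDeriv (j + 1) f u₁ = 0 ∧ iteratedDeriv j f u₁ ≠ 0 ∧ ‖u₁ - (v - (newtonK f j v)⁻¹)‖ ≤ 1 / (2 * ‖newtonK f j v‖) ∧
          ‖u₁ - (v - (newtonK f j v)⁻¹)‖ ≤ (9 / 5) * (μ₀ / (v.im * ‖newtonK f j v‖) ^ 2) / ‖newtonK f j v‖) ∧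
        (iteratedDeriv (j + 1) f u₂ = 0 ∧ iteratedDeriv j f u₂ ≠ 0 ∧ ‖u₂ - (z - (newtonK f j z)⁻¹)‖ ≤ 1 / (2 * ‖newtonK f j z‖) ∧
          ‖u₂ - (z - (newtonK f j z)⁻¹)‖ ≤ (9 / 5) * (μ₀ / (z.im * ‖newtonK f j z‖) ^ 2) / ‖newtonK f j z‖) := by
  obtain ⟨Mv, hMv, hWv⟩ := hLv
  obtain ⟨Mz, hMz, hWz⟩ := hLz
  have hMv0 : 0 ≤ Mv := hWv.2.1
  have hMz0 : 0 ≤ Mz := hWz.2.1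
  have hKv : 0 < ‖newtonK f j v‖ := by rw [← fieldK_dslope]; exact norm_pos_iff.mpr hWv.1
  have hKz : 0 < ‖newtonK f j z‖ := by rw [← fieldK_dslope]; exact norm_pos_iff.mpr hWz.1
  have hlv : 0 < v.im * ‖newtonK f j v‖ := mul_pos hv hKv
  have hlz : 0 < z.im * ‖newtonK f j z‖ := mul_pos hz hKz
  -- door smallness for the witnesses `Mv, Mz ≤ μ₀` at `C₀ = 9/2`
  have hdoor_v : (9 / 2) * (1 + Mv) ≤ (v.im * ‖newtonK f j v‖) ^ 2 / 2 := by linarith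
  have hdoor_z : (9 / 2) * (1 + Mz) ≤ (z.im * ‖newtonK f j z‖) ^ 2 / 2 := by linarith
  obtain ⟨hsv, hρv, u₁, hu₁0, hGu₁, -, hu₁disc, hu₁v, hu₁boot⟩ := located_child_of_lightWitness hE hFv hv hWv (le_refl _) hdoor_v
  obtain ⟨hsz, hρz, u₂, hu₂0, hGu₂, -, hu₂disc, hu₂z, hu₂boot⟩ := located_child_of_lightWitness hE hFz hz hWz (le_refl _) hdoor_z
  set ρv : ℝ := rhoMu (9 / 2) Mv (dslope (iteratedDeriv j f) v) v with hρvdef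
  set ρz : ℝ := rhoMu (9 / 2) Mz (dslope (iteratedDeriv j f) z) z with hρzdef
  -- field floors: `λ² ≥ 9(1+μ₀) ≥ 9`
  have hμ0 : 0 ≤ μ₀ := hMv0.trans hMv
  have hflv : 3 / 2 < v.im * ‖newtonK f j v‖ := by
    by_contra hle
    have h9 : (v.im * ‖newtonK f j v‖) ^ 2 ≤ (3 / 2) ^ 2 := by
      rw [sq, sq]; exact mul_self_le_mul_self hlv.le (not_lt.mp hle)
    nlinarith
  have hflz : 3 / 2 < z.im * ‖newtonK f j z‖ := by
    by_contra hle
    have h9 : (z.im * ‖newtonK f j z‖) ^ 2 ≤ (3 / 2) ^ 2 := by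
      rw [sq, sq]; exact mul_self_le_mul_self hlz.le (not_lt.mp hle)
    nlinarith
  -- S4 distinctness: the partner is outside each witness ball, each child within half that distance of its own centre
  have hsep_v : 3 / ‖newtonK f j v‖ < ‖z - v‖ := sep_of_lightWitness hFv hFz hvz.symm hWv
  have hsep_z : 3 / ‖newtonK f j z‖ < ‖v - z‖ := sep_of_lightWitness hFz hFv hvz hWz
  rw [norm_sub_rev v z] at hsep_z
  have h1 : ‖u₁ - v‖ < ‖z - v‖ / 2 := by
    have h2 : (1 + ρv) / ‖newtonK f j v‖ ≤ (3 / 2) / ‖newtonK f j v‖ := div_le_div_of_nonneg_right (by linarith) hKv.le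
    have h3 : (3 / 2) / ‖newtonK f j v‖ = (3 / ‖newtonK f j v‖) / 2 := by ring
    linarith [hu₁v.trans h2]
  have h2 : ‖u₂ - z‖ < ‖z - v‖ / 2 := by
    have h2 : (1 + ρz) / ‖newtonK f j z‖ ≤ (3 / 2) / ‖newtonK f j z‖ := div_le_div_of_nonneg_right (by linarith) hKz.le
    have h3 : (3 / 2) / ‖newtonK f j z‖ = (3 / ‖newtonK f j z‖) / 2 := by ring
    linarith [hu₂z.trans h2]
  have hne : u₁ ≠ u₂ := ne_of_half_separation h1 h2
  -- half-Newton discs and the sharp `(9/5)·μ₀` forms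
  have hhalf_v : ‖u₁ - (v - (newtonK f j v)⁻¹)‖ ≤ 1 / (2 * ‖newtonK f j v‖) := by
    refine hu₁disc.le.trans ?_
    rw [show 1 / (2 * ‖newtonK f j v‖) = (1 / 2) / ‖newtonK f j v‖ by ring]
    exact div_le_div_of_nonneg_right hρv hKv.le
  have hhalf_z : ‖u₂ - (z - (newtonK f j z)⁻¹)‖ ≤ 1 / (2 * ‖newtonK f j z‖) := by
    refine hu₂disc.le.trans ?_
    rw [show 1 / (2 * ‖newtonK f j z‖) = (1 / 2) / ‖newtonK f j z‖ by ring]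
    exact div_le_div_of_nonneg_right hρz hKz.le
  have hsharp_v : ‖u₁ - (v - (newtonK f j v)⁻¹)‖ ≤ (9 / 5) * (μ₀ / (v.im * ‖newtonK f j v‖) ^ 2) / ‖newtonK f j v‖ := by
    refine hu₁boot.trans (div_le_div_of_nonneg_right ?_ hKv.le)
    rw [show (6 : ℝ) / 5 * ((1 + ρv) * Mv / (v.im * ‖newtonK f j v‖) ^ 2) = (6 / 5 * ((1 + ρv) * Mv)) / (v.im * ‖newtonK f j v‖) ^ 2 by ring,
      show (9 : ℝ) / 5 * (μ₀ / (v.im * ‖newtonK f j v‖) ^ 2) = (9 / 5 * μ₀) / (v.im * ‖newtonK f j v‖) ^ 2 by ring]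
    refine div_le_div_of_nonneg_right ?_ (sq_nonneg _)
    have h4 : ρv * Mv ≤ 1 / 2 * Mv := mul_le_mul_of_nonneg_right hρv hMv0
    linarith
  have hsharp_z : ‖u₂ - (z - (newtonK f j z)⁻¹)‖ ≤ (9 / 5) * (μ₀ / (z.im * ‖newtonK f j z‖) ^ 2) / ‖newtonK f j z‖ := by
    refine hu₂boot.trans (div_le_div_of_nonneg_right ?_ hKz.le)
    rw [show (6 : ℝ) / 5 * ((1 + ρz) * Mz / (z.im * ‖newtonK f j z‖) ^ 2) = (6 / 5 * ((1 + ρz) * Mz)) / (z.im * ‖newtonK f j z‖) ^ 2 by ring,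
      show (9 : ℝ) / 5 * (μ₀ / (z.im * ‖newtonK f j z‖) ^ 2) = (9 / 5 * μ₀) / (z.im * ‖newtonK f j z‖) ^ 2 by ring]
    refine div_le_div_of_nonneg_right ?_ (sq_nonneg _)
    have h4 : ρz * Mz ≤ 1 / 2 * Mz := mul_le_mul_of_nonneg_right hρz hMz0
    linarith
  exact ⟨hsv, hsz, hflv, hflz, u₁, u₂, hne, ⟨hu₁0, hGu₁, hhalf_v, hsharp_v⟩, ⟨hu₂0, hGu₂, hhalf_z, hsharp_z⟩⟩

end RhW08.LocatedPair
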